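import Literature.MathematicalPhysics.QuantumManyBody.GroundStateFeynmanKacFreeForm
import Mathlib.Analysis.Calculus.ContDiff.Convolution
import Mathlib.Analysis.Calculus.BumpFunction.Normed
import Mathlib.Analysis.Calculus.BumpFunction.InnerProduct
import Mathlib.MeasureTheory.Integral.Pi
import Mathlib.MeasureTheory.Measure.Haar.Unique
import HarnessLib

/-!
# Ground-state Feynman–Kac: symmetric smooth trial functions from a ground-state candidate

Topic `Literature/MathematicalPhysics/QuantumManyBody`; support file for the proof of the named
fact `Literature.MathematicalPhysics.QuantumManyBody.BoseGas.GroundStateFeynmanKac` (variational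
identification of the top of the spectrum, Chung–Zhao (1995) Thm 3.27 / Prop 3.29: the density
step "`C_c^∞(D)` is dense in the form domain" of the proof of Prop 3.29, done here concretely for
the box). From a continuous, nonnegative, permutation-symmetric `Ψ₀` vanishing off `Λ_L^N` we build,
for `θ > 1`, the **dilated and mollified** function

  `trialFn L θ Ψ₀ = ρ_r ⋆ (X ↦ Ψ₀(θ X + (1 - θ) c))`,  `c` the centre, `r = L(θ-1)/(4θ)`,

with `ρ_r(Y) = ∏ᵢ β_r(Yᵢ)` a product of normalised radial bumps on `ℝ³` (`mollifier`), so that it is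
`C¹`, vanishes off the open box, is permutation symmetric, nonnegative and bounded like `Ψ₀`
(`contDiff_trialFn`, `trialFn_eq_zero`, `trialFn_comp_perm`, …), and

* `lintegral_realKinetic_trialFn_le` — its kinetic energy is controlled by the free small-time
  form of `Ψ₀`: if eventually `sqIncr t Ψ₀/(2t) ≤ K'` (`K' ≥ 0`) then
  `∫ |∇ trialFn|² ≤ θ² K'` (Fatou lower bound, mollification monotonicity and exact dilation
  covariance of `sqIncr`, all from `GroundStateFeynmanKacFreeForm`);
* `trialFn_tendsto_uniformly` — `sup |trialFn L θ Ψ₀ - Ψ₀| → 0` as `θ → 1⁺` (uniform continuity).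

## References

* K. L. Chung, Z. Zhao, *From Brownian Motion to Schrödinger's Equation* (1995), Prop 3.29 and
  its proof (density of `C_c^∞(D)` in `W₀^{1,2}(D)`). [ChungZhao1995]
* E. H. Lieb, R. Seiringer, J. P. Solovej, J. Yngvason (2005), §1.2 (1.16)–(1.17). [LSSY2005]
-/

noncomputable section

namespace Literature.MathematicalPhysics.QuantumManyBody.BoseGas

open MeasureTheory Filter Set
open scoped ENNReal NNReal Topology Convolution

variable {N : ℕ}

/-! ### The product mollifier -/

/-- A normalised radial bump on `ℝ³` of outer radius `r` (inner radius `r/2`). [folklore] -/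
def bumpOne {r : ℝ} (hr : 0 < r) : ContDiffBump (0 : Space) := ⟨r / 2, r, half_pos hr, half_lt_self hr⟩

/-- **The product mollifier** `ρ_r(Y) = ∏ᵢ β_r(Yᵢ)` on `(ℝ³)^N`: smooth, nonnegative, permutation
symmetric, supported in the sup-ball of radius `r`, of total mass one. [folklore] -/
def mollifier {r : ℝ} (hr : 0 < r) : Config N → ℝ := fun Y => ∏ i, (bumpOne hr).normed volume (Y i)

/-- The mollifier is nonnegative. [folklore] -/
theorem mollifier_nonneg {r : ℝ} (hr : 0 < r) (Y : Config N) : 0 ≤ mollifier hr Y :=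
  Finset.prod_nonneg fun _ _ => (bumpOne hr).nonneg_normed _

/-- The mollifier is smooth. [folklore] -/
theorem contDiff_mollifier {r : ℝ} (hr : 0 < r) {n : ℕ∞} : ContDiff ℝ n (mollifier (N := N) hr) := by
  unfold mollifier
  exact contDiff_prod fun i _ => (bumpOne hr).contDiff_normed.comp
    (ContinuousLinearMap.proj (R := ℝ) (φ := fun _ : Fin N => Space) i).contDiff

/-- The mollifier is continuous. [folklore] -/
theorem continuous_mollifier {r : ℝ} (hr : 0 < r) : Continuous (mollifier (N := N) hr) :=
  (contDiff_mollifier hr (n := 0)).continuous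

/-- The mollifier is measurable. [folklore] -/
theorem measurable_mollifier {r : ℝ} (hr : 0 < r) : Measurable (mollifier (N := N) hr) :=
  (continuous_mollifier hr).measurable

/-- The mollifier is supported in the open sup-ball of radius `r`. [folklore] -/
theorem norm_lt_of_mollifier_ne_zero {r : ℝ} (hr : 0 < r) {Y : Config N} (hY : mollifier hr Y ≠ 0) :
    ‖Y‖ < r := by
  rw [pi_norm_lt_iff hr]
  intro i
  have hi : (bumpOne hr).normed volume (Y i) ≠ 0 := fun h => hY (Finset.prod_eq_zero (Finset.mem_univ i) h)
  have hmem : Y i ∈ Function.support ((bumpOne hr).normed volume) := hi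
  rw [ContDiffBump.support_normed_eq] at hmem
  simpa [bumpOne] using hmem

/-- The mollifier has compact support. [folklore] -/
theorem hasCompactSupport_mollifier {r : ℝ} (hr : 0 < r) : HasCompactSupport (mollifier (N := N) hr) :=
  HasCompactSupport.intro (isCompact_closedBall (0 : Config N) r) fun Y hY => by
    by_contra h
    exact hY (Metric.mem_closedBall.2 (by simpa using (norm_lt_of_mollifier_ne_zero hr h).le))

/-- The mollifier is integrable. [folklore] -/
theorem integrable_mollifier {r : ℝ} (hr : 0 < r) : Integrable (mollifier (N := N) hr) volume :=
  (continuous_mollifier hr).integrable_of_hasCompactSupport (hasCompactSupport_mollifier hr)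

/-- **The mollifier has total mass one** (product of one-particle masses). [folklore] -/
theorem integral_mollifier {r : ℝ} (hr : 0 < r) : ∫ Y : Config N, mollifier hr Y = 1 := by
  unfold mollifier
  rw [integral_fintype_prod_volume_eq_prod (𝕜 := ℝ) (fun _ : Fin N => (bumpOne hr).normed volume)]
  simp [ContDiffBump.integral_normed]

/-- The mollifier is permutation symmetric. [folklore] -/
theorem mollifier_comp_perm {r : ℝ} (hr : 0 < r) (σ : Equiv.Perm (Fin N)) (Y : Config N) :
    mollifier hr (Y ∘ σ) = mollifier hr Y := by
  unfold mollifier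
  exact Equiv.prod_comp σ (fun i => (bumpOne hr).normed volume (Y i))

/-- The mollifier is bounded. [folklore] -/
theorem exists_mollifier_le {r : ℝ} (hr : 0 < r) : ∃ B : ℝ, ∀ Y : Config N, mollifier hr Y ≤ B := by
  obtain ⟨B, hB⟩ := (hasCompactSupport_mollifier (N := N) hr).exists_bound_of_continuous
    (continuous_mollifier hr)
  exact ⟨B, fun Y => (le_abs_self _).trans (by simpa [Real.norm_eq_abs] using hB Y)⟩

/-! ### Mollification as an average -/

/-- **Mollification** `(ρ_r ⋆ g)(X) = ∫ ρ_r(Y) g(X - Y) dY`. [folklore] -/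
def mollify {r : ℝ} (hr : 0 < r) (g : Config N → ℝ) : Config N → ℝ :=
  fun X => ∫ Y, mollifier hr Y * g (X - Y)

/-- Mollification is Mathlib's convolution with the scalar-multiplication pairing. [folklore] -/
theorem mollify_eq_convolution {r : ℝ} (hr : 0 < r) (g : Config N → ℝ) :
    mollify hr g = (mollifier hr ⋆[ContinuousLinearMap.lsmul ℝ ℝ, volume] g) := by
  funext X
  rw [convolution_lsmul]
  rfl

/-- **Mollification of a locally integrable function is `C¹`.** [folklore] -/
theorem contDiff_mollify {r : ℝ} (hr : 0 < r) {g : Config N → ℝ} (hg : LocallyIntegrable g volume) :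
    ContDiff ℝ 1 (mollify hr g) := by
  haveI : (volume : Measure (Config N)).IsNegInvariant := by
    refine ⟨?_⟩
    have h := Measure.map_addHaar_smul (volume : Measure (Config N)) (r := (-1 : ℝ)) (by norm_num)
    have hneg : (fun x : Config N => (-1 : ℝ) • x) = Neg.neg := by funext x; simp
    rw [hneg] at h
    rw [Measure.neg, h]
    simp
  rw [mollify_eq_convolution]
  exact (hasCompactSupport_mollifier hr).contDiff_convolution_left _ (contDiff_mollifier hr (n := 1)) hg

/-- The mollifying probability measure `ρ_r(Y) dY`. [folklore] -/
def mollifierMeasure {r : ℝ} (hr : 0 < r) : Measure (Config N) :=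
  volume.withDensity fun Y => ENNReal.ofReal (mollifier hr Y)

/-- The mollifying measure is a probability measure. [folklore] -/
instance isProbabilityMeasure_mollifierMeasure {r : ℝ} (hr : 0 < r) :
    IsProbabilityMeasure (mollifierMeasure (N := N) hr) := by
  refine ⟨?_⟩
  rw [mollifierMeasure, withDensity_apply _ MeasurableSet.univ, Measure.restrict_univ,
    ← ofReal_integral_eq_lintegral_ofReal (integrable_mollifier hr)
      (Eventually.of_forall (mollifier_nonneg hr)), integral_mollifier, ENNReal.ofReal_one]

/-- **Mollification as an average**: `(ρ_r ⋆ g)(X) = ∫ g(X - Y) dν_r(Y)`. [folklore] -/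
theorem mollify_eq_integral_measure {r : ℝ} (hr : 0 < r) (g : Config N → ℝ) (X : Config N) :
    mollify hr g X = ∫ Y, g (X - Y) ∂mollifierMeasure hr := by
  have hm : Measurable fun Y : Config N => ENNReal.ofReal (mollifier hr Y) :=
    ENNReal.measurable_ofReal.comp (measurable_mollifier hr)
  show (∫ Y, mollifier hr Y * g (X - Y)) = _
  rw [mollifierMeasure, integral_withDensity_eq_integral_toReal_smul hm
    (Eventually.of_forall fun Y => ENNReal.ofReal_lt_top)]
  refine integral_congr_ae (Eventually.of_forall fun Y => ?_)
  simp only [ENNReal.toReal_ofReal (mollifier_nonneg hr Y), smul_eq_mul]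

/-- The mollified integrand is integrable for bounded measurable `g`. [folklore] -/
theorem integrable_mollifier_mul {r : ℝ} (hr : 0 < r) {g : Config N → ℝ} (hg : Measurable g) {M : ℝ}
    (hM : ∀ X, |g X| ≤ M) (X : Config N) : Integrable (fun Y => mollifier hr Y * g (X - Y)) volume := by
  refine ((integrable_mollifier hr).mul_const M).mono'
    ((measurable_mollifier hr).mul (hg.comp (measurable_const.sub measurable_id))).aestronglyMeasurable
    (Eventually.of_forall fun Y => ?_)
  rw [Real.norm_eq_abs, abs_mul, abs_of_nonneg (mollifier_nonneg hr Y)]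
  exact mul_le_mul_of_nonneg_left (hM _) (mollifier_nonneg hr Y)

/-- **Mollification approximates uniformly**: if `|g(X - Y) - g(X)| ≤ η` for `‖Y‖ < r`, then
`|(ρ_r ⋆ g)(X) - g(X)| ≤ η`. [folklore] -/
theorem abs_mollify_sub_le {r : ℝ} (hr : 0 < r) {g : Config N → ℝ} (hg : Measurable g) {M : ℝ}
    (hM : ∀ X, |g X| ≤ M) {X : Config N} {η : ℝ}
    (h : ∀ Y, ‖Y‖ < r → |g (X - Y) - g X| ≤ η) : |mollify hr g X - g X| ≤ η := by
  have hint := integrable_mollifier_mul hr hg hM X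
  have h1 : mollify hr g X - g X = ∫ Y, mollifier hr Y * (g (X - Y) - g X) := by
    have h2 : ∫ Y : Config N, mollifier hr Y * g X = g X := by
      rw [integral_mul_const, integral_mollifier, one_mul]
    have h3 : ∫ Y : Config N, mollifier hr Y * (g (X - Y) - g X) =
        (∫ Y : Config N, mollifier hr Y * g (X - Y)) - ∫ Y : Config N, mollifier hr Y * g X := by
      rw [← integral_sub hint ((integrable_mollifier hr).mul_const _)]
      refine integral_congr_ae (Eventually.of_forall fun Y => ?_)
      ring
    rw [h3, h2]
    rfl
  rw [h1, ← Real.norm_eq_abs]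
  have hpt : ∀ Y, ‖mollifier hr Y * (g (X - Y) - g X)‖ ≤ mollifier hr Y * η := by
    intro Y
    rw [Real.norm_eq_abs, abs_mul, abs_of_nonneg (mollifier_nonneg hr Y)]
    by_cases hY : mollifier hr Y = 0
    · rw [hY, zero_mul, zero_mul]
    · exact mul_le_mul_of_nonneg_left (h Y (norm_lt_of_mollifier_ne_zero hr hY)) (mollifier_nonneg hr Y)
  calc ‖∫ Y, mollifier hr Y * (g (X - Y) - g X)‖ ≤ ∫ Y, mollifier hr Y * η :=
        norm_integral_le_of_norm_le ((integrable_mollifier hr).mul_const η) (Eventually.of_forall hpt)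
    _ = η := by rw [integral_mul_const, integral_mollifier, one_mul]

/-- **Mollification is bounded like the function**: `|(ρ_r ⋆ g)(X)| ≤ sup |g|`. [folklore] -/
theorem abs_mollify_le {r : ℝ} (hr : 0 < r) {g : Config N → ℝ} {M : ℝ}
    (hM : ∀ X, |g X| ≤ M) (X : Config N) : |mollify hr g X| ≤ M := by
  rw [mollify, ← Real.norm_eq_abs]
  calc ‖∫ Y, mollifier hr Y * g (X - Y)‖ ≤ ∫ Y, mollifier hr Y * M := by
        refine norm_integral_le_of_norm_le ((integrable_mollifier hr).mul_const M)
          (Eventually.of_forall fun Y => ?_)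
        rw [Real.norm_eq_abs, abs_mul, abs_of_nonneg (mollifier_nonneg hr Y)]
        exact mul_le_mul_of_nonneg_left (hM _) (mollifier_nonneg hr Y)
    _ = M := by rw [integral_mul_const, integral_mollifier, one_mul]

/-- Mollification of a nonnegative function is nonnegative. [folklore] -/
theorem mollify_nonneg {r : ℝ} (hr : 0 < r) {g : Config N → ℝ} (hg0 : ∀ X, 0 ≤ g X) (X : Config N) :
    0 ≤ mollify hr g X :=
  integral_nonneg fun Y => mul_nonneg (mollifier_nonneg hr Y) (hg0 _)

/-- **Support of the mollification**: if `g(X - Y) = 0` whenever `‖Y‖ < r`, then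
`(ρ_r ⋆ g)(X) = 0`. [folklore] -/
theorem mollify_eq_zero {r : ℝ} (hr : 0 < r) {g : Config N → ℝ} {X : Config N}
    (h : ∀ Y, ‖Y‖ < r → g (X - Y) = 0) : mollify hr g X = 0 := by
  rw [mollify]
  refine integral_eq_zero_of_ae (Eventually.of_forall fun Y => ?_)
  by_cases hY : mollifier hr Y = 0
  · simp [hY]
  · simp [h Y (norm_lt_of_mollifier_ne_zero hr hY)]

/-- Relabelling the particles as a measurable equivalence of `(ℝ³)^N`. [folklore] -/
theorem piCongrLeft_symm_apply (σ : Equiv.Perm (Fin N)) (X : Config N) :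
    (MeasurableEquiv.piCongrLeft (fun _ : Fin N => Space) σ.symm) X = X ∘ σ := by
  funext j
  simp [MeasurableEquiv.piCongrLeft, Equiv.piCongrLeft_apply_eq_cast]

/-- Lebesgue measure on `(ℝ³)^N` is invariant under relabelling (Bochner form):
`∫ F(X ∘ σ) dX = ∫ F`. [folklore] -/
theorem integral_comp_perm (σ : Equiv.Perm (Fin N)) (F : Config N → ℝ) :
    ∫ X : Config N, F (X ∘ σ) = ∫ X, F X := by
  have hmp := volume_measurePreserving_piCongrLeft (fun _ : Fin N => Space) σ.symm
  have := hmp.integral_comp' (f := MeasurableEquiv.piCongrLeft (fun _ : Fin N => Space) σ.symm) F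
  simpa only [piCongrLeft_symm_apply] using this

/-- **Mollification preserves permutation symmetry.** [folklore] -/
theorem mollify_comp_perm {r : ℝ} (hr : 0 < r) {g : Config N → ℝ}
    (hg : ∀ (σ : Equiv.Perm (Fin N)) (X : Config N), g (X ∘ σ) = g X)
    (σ : Equiv.Perm (Fin N)) (X : Config N) : mollify hr g (X ∘ σ) = mollify hr g X := by
  rw [mollify, mollify, ← integral_comp_perm σ (fun Y => mollifier hr Y * g (X ∘ σ - Y))]
  refine integral_congr_ae (Eventually.of_forall fun Y => ?_)
  simp only
  rw [mollifier_comp_perm hr σ Y]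
  congr 1
  have : X ∘ σ - Y ∘ σ = (X - Y) ∘ σ := rfl
  rw [this, hg]

/-! ### The dilation about the centre of the box -/

/-- The centre `(L/2, …, L/2)` of the box `Λ_L^N`. [folklore] -/
def boxCentre (N : ℕ) (L : ℝ) : Config N := fun _ => WithLp.toLp 2 fun _ : Fin 3 => L / 2

/-- Coordinates of the centre. [folklore] -/
@[simp] theorem boxCentre_apply (L : ℝ) (i : Fin N) (k : Fin 3) : boxCentre N L i k = L / 2 := rfl

/-- **Dilation about the centre**: `(dilateFn L θ Ψ₀)(X) = Ψ₀(θX + (1-θ)c)`, which shrinks the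
support of `Ψ₀` towards the centre by the factor `θ`. [folklore] -/
def dilateFn (L θ : ℝ) (Ψ₀ : Config N → ℝ) : Config N → ℝ :=
  fun X => Ψ₀ (θ • X + (1 - θ) • boxCentre N L)

/-- Coordinates of the dilated point. [folklore] -/
theorem dilate_apply (L θ : ℝ) (X : Config N) (i : Fin N) (k : Fin 3) :
    (θ • X + (1 - θ) • boxCentre N L) i k = θ * X i k + (1 - θ) * (L / 2) := by
  simp [boxCentre]

/-- The dilation is continuous for continuous `Ψ₀`. [folklore] -/
theorem continuous_dilateFn {L θ : ℝ} {Ψ₀ : Config N → ℝ} (h : Continuous Ψ₀) :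
    Continuous (dilateFn L θ Ψ₀) :=
  h.comp ((continuous_const_smul θ).add continuous_const)

/-- The dilation preserves permutation symmetry. [folklore] -/
theorem dilateFn_comp_perm {L θ : ℝ} {Ψ₀ : Config N → ℝ}
    (hsymm : ∀ (σ : Equiv.Perm (Fin N)) (X : Config N), Ψ₀ (X ∘ σ) = Ψ₀ X)
    (σ : Equiv.Perm (Fin N)) (X : Config N) : dilateFn L θ Ψ₀ (X ∘ σ) = dilateFn L θ Ψ₀ X := by
  unfold dilateFn
  have : θ • (X ∘ σ) + (1 - θ) • boxCentre N L = (θ • X + (1 - θ) • boxCentre N L) ∘ σ := by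
    funext j; simp [boxCentre]
  rw [this, hsymm]

/-- **Support of the dilation**: for `θ > 0`, if `(dilateFn L θ Ψ₀)(X) ≠ 0` for a `Ψ₀` vanishing off
the box then every coordinate satisfies `|X_{ik} - L/2| < L/(2θ)`. [folklore] -/
theorem abs_sub_lt_of_dilateFn_ne_zero {L θ : ℝ} (hθ : 0 < θ) {Ψ₀ : Config N → ℝ}
    (h0 : ∀ X, X ∉ boxN N L → Ψ₀ X = 0) {X : Config N} (hX : dilateFn L θ Ψ₀ X ≠ 0)
    (i : Fin N) (k : Fin 3) : |X i k - L / 2| < L / (2 * θ) := by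
  have hmem : θ • X + (1 - θ) • boxCentre N L ∈ boxN N L := by
    by_contra h
    exact hX (h0 _ h)
  have hik := (hmem i) k
  rw [dilate_apply] at hik
  obtain ⟨h1, h2⟩ := hik
  have key : θ * |X i k - L / 2| < L / 2 := by
    have : |θ * (X i k - L / 2)| < L / 2 := by
      rw [abs_lt]; constructor <;> nlinarith
    rwa [abs_mul, abs_of_pos hθ] at this
  rw [lt_div_iff₀ (by positivity : (0 : ℝ) < 2 * θ)]
  nlinarith [key, abs_nonneg (X i k - L / 2)]

/-! ### The trial function -/

/-- The mollification radius `r(θ) = L(θ-1)/(4θ)` (with the junk value `1` when this is not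
positive, so that the radius is always positive). [folklore] -/
def mollRadius (L θ : ℝ) : ℝ := if 0 < L * (θ - 1) / (4 * θ) then L * (θ - 1) / (4 * θ) else 1

/-- The mollification radius is positive. [folklore] -/
theorem mollRadius_pos (L θ : ℝ) : 0 < mollRadius L θ := by
  unfold mollRadius; split_ifs with h
  · exact h
  · exact one_pos

/-- For `L > 0`, `θ > 1` the radius is `L(θ-1)/(4θ)`. [folklore] -/
theorem mollRadius_eq {L θ : ℝ} (hL : 0 < L) (hθ : 1 < θ) : mollRadius L θ = L * (θ - 1) / (4 * θ) := by
  unfold mollRadius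
  rw [if_pos (by apply div_pos (mul_pos hL (by linarith)) (by linarith))]

/-- **The trial function** `ρ_{r(θ)} ⋆ (X ↦ Ψ₀(θX + (1-θ)c))`. [folklore] -/
def trialFn (L θ : ℝ) (Ψ₀ : Config N → ℝ) : Config N → ℝ :=
  mollify (mollRadius_pos L θ) (dilateFn L θ Ψ₀)

section Properties

variable {L θ : ℝ} {Ψ₀ : Config N → ℝ}

/-- The trial function is `C¹`. [folklore] -/
theorem contDiff_trialFn (hcont : Continuous Ψ₀) : ContDiff ℝ 1 (trialFn L θ Ψ₀) :=
  contDiff_mollify _ (continuous_dilateFn hcont).locallyIntegrable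

/-- The trial function is nonnegative. [folklore] -/
theorem trialFn_nonneg (hnn : ∀ X, 0 ≤ Ψ₀ X) (X : Config N) : 0 ≤ trialFn L θ Ψ₀ X :=
  mollify_nonneg _ (fun _ => hnn _) X

/-- The trial function is bounded like `Ψ₀`. [folklore] -/
theorem abs_trialFn_le {M : ℝ} (hM : ∀ X, |Ψ₀ X| ≤ M) (X : Config N) : |trialFn L θ Ψ₀ X| ≤ M :=
  abs_mollify_le _ (fun _ => hM _) X

/-- The trial function is permutation symmetric. [folklore] -/
theorem trialFn_comp_perm (hsymm : ∀ (σ : Equiv.Perm (Fin N)) (X : Config N), Ψ₀ (X ∘ σ) = Ψ₀ X)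
    (σ : Equiv.Perm (Fin N)) (X : Config N) : trialFn L θ Ψ₀ (X ∘ σ) = trialFn L θ Ψ₀ X :=
  mollify_comp_perm _ (dilateFn_comp_perm hsymm) σ X

/-- A coordinate is bounded by the sup-norm (local copy of the tree's `abs_apply_le_norm` of
`PeriodicBoseGasJastrow.lean`, outside this import cone). [folklore] -/
private theorem abs_apply_le_norm_aux (Y : Config N) (i : Fin N) (k : Fin 3) : |Y i k| ≤ ‖Y‖ := by
  have h1 : |Y i k| ≤ ‖Y i‖ := by
    have := PiLp.norm_apply_le (Y i) k
    simpa using this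
  exact h1.trans (norm_le_pi_norm Y i)

/-- **The trial function vanishes off the open box** (`L > 0`, `θ > 1`): the dilation moves the
support at distance `≥ L(θ-1)/(2θ)` from the boundary and the mollifier only spreads it by
`L(θ-1)/(4θ)`. [folklore] -/
theorem trialFn_eq_zero (hL : 0 < L) (hθ : 1 < θ) (h0 : ∀ X, X ∉ boxN N L → Ψ₀ X = 0)
    (X : Config N) (hX : X ∉ boxN N L) : trialFn L θ Ψ₀ X = 0 := by
  have hθ0 : 0 < θ := by linarith
  refine mollify_eq_zero _ fun Y hY => ?_
  rw [mollRadius_eq hL hθ] at hY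
  by_contra hne
  apply hX
  intro i k
  have h1 := abs_sub_lt_of_dilateFn_ne_zero hθ0 h0 hne i k
  have h2 : |Y i k| < L * (θ - 1) / (4 * θ) := (abs_apply_le_norm_aux Y i k).trans_lt hY
  simp only [Pi.sub_apply, PiLp.sub_apply] at h1
  -- `|X_ik - L/2| < L/(2θ) + L(θ-1)/(4θ) = L(θ+1)/(4θ) < L/2`
  have h3 : |X i k - L / 2| < L / (2 * θ) + L * (θ - 1) / (4 * θ) := by
    calc |X i k - L / 2| = |(X i k - Y i k - L / 2) + Y i k| := by ring_nf
      _ ≤ |X i k - Y i k - L / 2| + |Y i k| := abs_add_le _ _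
      _ < _ := add_lt_add h1 h2
  have h4 : L / (2 * θ) + L * (θ - 1) / (4 * θ) < L / 2 := by
    have hr : 0 < L * (θ - 1) / (4 * θ) := div_pos (mul_pos hL (by linarith)) (by positivity)
    have heq : L / (2 * θ) + L * (θ - 1) / (4 * θ) = L / 2 - L * (θ - 1) / (4 * θ) := by
      field_simp; ring
    linarith
  have h5 := (abs_sub_lt_iff.1 (h3.trans h4))
  constructor <;> linarith [h5.1, h5.2]

end Properties

/-! ### The kinetic energy of the trial function -/

/-- Multiplication by a positive constant preserves `𝓝[>] 0` on `ℝ≥0`. [folklore] -/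
theorem tendsto_const_mul_nhdsGT_zero {c : ℝ≥0} (hc : c ≠ 0) :
    Tendsto (fun t : ℝ≥0 => c * t) (𝓝[>] (0 : ℝ≥0)) (𝓝[>] (0 : ℝ≥0)) := by
  refine tendsto_nhdsWithin_iff.2 ⟨?_, ?_⟩
  · have := ((continuous_const_mul c).tendsto (0 : ℝ≥0))
    rw [mul_zero] at this
    exact this.mono_left nhdsWithin_le_nhds
  · filter_upwards [self_mem_nhdsWithin] with t ht
    exact mul_pos (pos_iff_ne_zero.2 hc) ht

/-- **The kinetic energy of the trial function is controlled by the free small-time form of `Ψ₀`**: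
if eventually `sqIncr t Ψ₀ / (2t) ≤ K'` as `t → 0⁺`, then for `θ > 1`
`∫ |∇ trialFn L θ Ψ₀|² ≤ θ² K'` (Fatou lower bound for the `C¹` trial function, mollification
monotonicity, exact dilation covariance `sqIncr t (Ψ₀(θ · + w)) = θ^{-3N} sqIncr (θ²t) Ψ₀` and
`θ^{-3N} ≤ 1`). [cite: ChungZhao1995, Prop 3.29 (81)] -/
theorem lintegral_realKinetic_trialFn_le {L θ : ℝ} (hθ : 1 < θ) {Ψ₀ : Config N → ℝ}
    (hcont : Continuous Ψ₀) {M : ℝ} (hM : ∀ X, |Ψ₀ X| ≤ M) {K' : ℝ}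
    (hev : ∀ᶠ t : ℝ≥0 in 𝓝[>] 0, (ENNReal.ofReal (2 * t))⁻¹ * sqIncr t Ψ₀ ≤ ENNReal.ofReal K') :
    ∫⁻ X, realKinetic (trialFn L θ Ψ₀) X ≤ ENNReal.ofReal (θ ^ 2 * K') := by
  have hθ0 : 0 < θ := by linarith
  set θ' : ℝ≥0 := ⟨θ, hθ0.le⟩ with hθ'
  have hθ'0 : θ' ≠ 0 := fun h => hθ0.ne' (by rw [← NNReal.coe_eq_zero] at h; exact h)
  have hcoe : (θ' : ℝ) = θ := rfl
  have hΨm : Measurable Ψ₀ := hcont.measurable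
  set g := dilateFn L θ Ψ₀ with hg
  have hgm : Measurable g := (continuous_dilateFn hcont).measurable
  have hgb : ∀ X, |g X| ≤ M := fun X => hM _
  set φ := trialFn L θ Ψ₀ with hφ
  have hφC : ContDiff ℝ 1 φ := contDiff_trialFn hcont
  -- Step 1: Fatou
  refine (kinetic_le_liminf_sqIncr hφC).trans ?_
  -- Step 2: an eventual bound of the rescaled increments of `φ`
  set B : ℝ≥0∞ := ENNReal.ofReal (θ ^ 2 * K') with hB
  have hbound : ∀ᶠ t : ℝ≥0 in 𝓝[>] 0, (ENNReal.ofReal (2 * t))⁻¹ * sqIncr t φ ≤ B := by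
    have hev' := (tendsto_const_mul_nhdsGT_zero (c := θ' ^ 2) (pow_ne_zero _ hθ'0)).eventually hev
    filter_upwards [hev', self_mem_nhdsWithin] with t ht htpos
    have ht0 : (t : ℝ≥0) ≠ 0 := ne_of_gt htpos
    have ht' : (0 : ℝ) < t := by exact_mod_cast htpos
    -- mollification and dilation
    have h1 : sqIncr t φ ≤ sqIncr t g := by
      have hrepr : φ = fun x => ∫ y, g (x - y) ∂mollifierMeasure (mollRadius_pos L θ) := by
        funext x; exact mollify_eq_integral_measure _ g x
      rw [hrepr]
      exact sqIncr_conv_le hgm hgb _ t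
    have h2 : sqIncr t g = ENNReal.ofReal |((θ' : ℝ) ^ Module.finrank ℝ (Config N))⁻¹| *
        sqIncr (θ' ^ 2 * t) Ψ₀ := by
      exact sqIncr_dilate hΨm hθ'0 ((1 - θ) • boxCentre N L) t
    -- the prefactor: `(2t)⁻¹ = θ² (2θ²t)⁻¹`
    have h2t : ENNReal.ofReal (2 * t) ≠ 0 := (ENNReal.ofReal_pos.2 (by positivity)).ne'
    have hθ2 : ENNReal.ofReal (θ ^ 2) ≠ 0 := (ENNReal.ofReal_pos.2 (by positivity)).ne'
    have hpre : (ENNReal.ofReal (2 * t))⁻¹ =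
        ENNReal.ofReal (θ ^ 2) * (ENNReal.ofReal (2 * ((θ' ^ 2 * t : ℝ≥0) : ℝ)))⁻¹ := by
      have hprod : ENNReal.ofReal (2 * ((θ' ^ 2 * t : ℝ≥0) : ℝ)) = ENNReal.ofReal (θ ^ 2) * ENNReal.ofReal (2 * t) := by
        rw [← ENNReal.ofReal_mul (by positivity)]
        congr 1; push_cast; rw [hcoe]; ring
      rw [hprod, ENNReal.mul_inv (Or.inl hθ2) (Or.inl ENNReal.ofReal_ne_top), ← mul_assoc,
        ENNReal.mul_inv_cancel hθ2 ENNReal.ofReal_ne_top, one_mul]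
    -- `θ^{-3N} ≤ 1`
    have hpow : ENNReal.ofReal |((θ' : ℝ) ^ Module.finrank ℝ (Config N))⁻¹| ≤ 1 := by
      rw [hcoe, abs_of_nonneg (inv_nonneg.2 (pow_nonneg hθ0.le _))]
      refine ENNReal.ofReal_le_one.2 (inv_le_one_of_one_le₀ (one_le_pow₀ hθ.le))
    calc (ENNReal.ofReal (2 * t))⁻¹ * sqIncr t φ ≤ (ENNReal.ofReal (2 * t))⁻¹ * sqIncr t g :=
          mul_le_mul' le_rfl h1
      _ = ENNReal.ofReal |((θ' : ℝ) ^ Module.finrank ℝ (Config N))⁻¹| * (ENNReal.ofReal (θ ^ 2) *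
          ((ENNReal.ofReal (2 * ((θ' ^ 2 * t : ℝ≥0) : ℝ)))⁻¹ * sqIncr (θ' ^ 2 * t) Ψ₀)) := by
          rw [h2, hpre]; ring
      _ ≤ 1 * (ENNReal.ofReal (θ ^ 2) * ENNReal.ofReal K') := by
          gcongr
      _ = B := by rw [one_mul, hB, ENNReal.ofReal_mul (by positivity)]
  -- Step 3: liminf ≤ eventual bound
  calc liminf (fun t : ℝ≥0 => (ENNReal.ofReal (2 * t))⁻¹ * sqIncr t φ) (𝓝[>] 0)
      ≤ liminf (fun _ : ℝ≥0 => B) (𝓝[>] 0) := liminf_le_liminf hbound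
    _ = B := liminf_const B

/-! ### Uniform convergence to `Ψ₀` as `θ → 1⁺` -/

/-- **`sup |trialFn L θ Ψ₀ - Ψ₀| → 0` as `θ → 1⁺`** for a continuous `Ψ₀` vanishing off the box
(`L > 0`): uniform continuity, since the dilation displaces points of the box by at most
`(θ - 1)·3|L|` and the mollifier by at most `L(θ-1)/(4θ)`. [folklore] -/
theorem trialFn_tendsto_uniformly {L : ℝ} (hL : 0 < L) {Ψ₀ : Config N → ℝ} (hcont : Continuous Ψ₀)
    (h0 : ∀ X, X ∉ boxN N L → Ψ₀ X = 0) {η : ℝ} (hη : 0 < η) :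
    ∀ᶠ θ : ℝ in 𝓝[>] 1, ∀ X, |trialFn L θ Ψ₀ X - Ψ₀ X| ≤ η := by
  -- data of `Ψ₀`
  have hcs : HasCompactSupport Ψ₀ :=
    HasCompactSupport.intro (isCompact_closedBall (0 : Config N) (3 * |L|))
      fun X hX => h0 X fun hb => hX (boxN_subset_closedBall N L hb)
  have hΨm : Measurable Ψ₀ := hcont.measurable
  obtain ⟨M0, hM0⟩ := hcs.exists_bound_of_continuous hcont
  have hM : ∀ X, |Ψ₀ X| ≤ M0 := fun X => by rw [← Real.norm_eq_abs]; exact hM0 X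
  have hUC := hcs.uniformContinuous_of_continuous hcont
  obtain ⟨δ, hδ, hδUC⟩ := Metric.uniformContinuous_iff.1 hUC (η / 2) (half_pos hη)
  have hUC' : ∀ a b : Config N, dist a b < δ → |Ψ₀ a - Ψ₀ b| ≤ η / 2 := fun a b hab => by
    have := hδUC hab; rw [Real.dist_eq] at this; exact this.le
  set c : Config N := boxCentre N L with hc
  set R : ℝ := 3 * |L| + ‖c‖ + 1 with hR
  have hR0 : 0 < R := by positivity
  -- points that matter are within `R` of the centre
  have hnear : ∀ Z : Config N, Z ∈ boxN N L → ‖Z - c‖ < R := by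
    intro Z hZ
    have h1 : ‖Z‖ ≤ 3 * |L| := mem_closedBall_zero_iff.1 (boxN_subset_closedBall N L hZ)
    calc ‖Z - c‖ ≤ ‖Z‖ + ‖c‖ := norm_sub_le _ _
      _ < R := by rw [hR]; linarith
  -- the margin
  set m : ℝ := min (δ / R) (4 * δ / L) with hm
  have hm0 : 0 < m := lt_min (div_pos hδ hR0) (div_pos (by linarith) hL)
  filter_upwards [Ioo_mem_nhdsGT (show (1 : ℝ) < 1 + m by linarith)] with θ hθ X
  obtain ⟨hθ1, hθ2⟩ := hθ
  have hθ0 : 0 < θ := by linarith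
  have hθm1 : θ - 1 < δ / R := by linarith [min_le_left (δ / R) (4 * δ / L)]
  have hθm2 : θ - 1 < 4 * δ / L := by linarith [min_le_right (δ / R) (4 * δ / L)]
  set g := dilateFn L θ Ψ₀ with hg
  have hgm : Measurable g := (continuous_dilateFn hcont).measurable
  have hgb : ∀ X, |g X| ≤ M0 := fun X => hM _
  -- (a) the dilation error
  have ha : |g X - Ψ₀ X| ≤ η / 2 := by
    set A : Config N := θ • X + (1 - θ) • c with hA
    have hgX : g X = Ψ₀ A := rfl
    by_cases hcase : X ∈ boxN N L ∨ A ∈ boxN N L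
    · -- `‖X - c‖ < R`, hence `dist A X = (θ - 1)‖X - c‖ < δ`
      have hXc : ‖X - c‖ < R := by
        rcases hcase with hX | hAmem
        · exact hnear X hX
        · have hAc : A - c = θ • (X - c) := by
            simp only [hA, smul_sub, sub_smul, one_smul]; abel
          have h1 := hnear A hAmem
          rw [hAc, norm_smul, Real.norm_of_nonneg hθ0.le] at h1
          have h2 : ‖X - c‖ ≤ θ * ‖X - c‖ := le_mul_of_one_le_left (norm_nonneg _) hθ1.le
          linarith
      have hdist : dist A X < δ := by
        have hAX : A - X = (θ - 1) • (X - c) := by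
          simp only [hA, smul_sub, sub_smul, one_smul]; abel
        rw [dist_eq_norm, hAX, norm_smul, Real.norm_of_nonneg (by linarith : 0 ≤ θ - 1)]
        calc (θ - 1) * ‖X - c‖ ≤ (θ - 1) * R := mul_le_mul_of_nonneg_left hXc.le (by linarith)
          _ < δ / R * R := mul_lt_mul_of_pos_right hθm1 hR0
          _ = δ := div_mul_cancel₀ δ hR0.ne'
      rw [hgX]
      exact hUC' A X hdist
    · -- both vanish
      simp only [not_or] at hcase
      rw [hgX, h0 A hcase.2, h0 X hcase.1, sub_zero, abs_zero]
      positivity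
  -- (b) the mollification error
  have hb : |trialFn L θ Ψ₀ X - g X| ≤ η / 2 := by
    refine abs_mollify_sub_le _ hgm hgb fun Y hY => ?_
    rw [mollRadius_eq hL hθ1] at hY
    set A : Config N := θ • X + (1 - θ) • c with hA
    have h1 : g (X - Y) = Ψ₀ (A - θ • Y) := by
      simp only [hg, dilateFn, hA, smul_sub]
      congr 1; abel
    have h2 : g X = Ψ₀ A := rfl
    rw [h1, h2]
    refine hUC' _ _ ?_
    rw [dist_eq_norm, sub_sub_cancel_left, norm_neg, norm_smul, Real.norm_of_nonneg hθ0.le]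
    calc θ * ‖Y‖ < θ * (L * (θ - 1) / (4 * θ)) := mul_lt_mul_of_pos_left hY hθ0
      _ = L * (θ - 1) / 4 := by field_simp
      _ < L * (4 * δ / L) / 4 := by gcongr
      _ = δ := by field_simp
  calc |trialFn L θ Ψ₀ X - Ψ₀ X| = |(trialFn L θ Ψ₀ X - g X) + (g X - Ψ₀ X)| := by ring_nf
    _ ≤ |trialFn L θ Ψ₀ X - g X| + |g X - Ψ₀ X| := abs_add_le _ _
    _ ≤ η / 2 + η / 2 := add_le_add hb ha
    _ = η := by ring

end Literature.MathematicalPhysics.QuantumManyBody.BoseGas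

end
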